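import Literature.NumberTheory.EllipticCurves.MazurTorsionProofs
import Literature.NumberTheory.EllipticCurves.KleinFrickeLevelThirteen
import Literature.NumberTheory.EllipticCurves.GaloisAction
import Literature.NumberTheory.EllipticCurves.Szpiro
import HarnessLib

/-!
# STUB-IDEAS k=1 gen 8 — Plan C ("torsion road" for the 13-adic input), typed for the record.
AUDITED AND PARKED (dominated by Plan B = KF13): see STUB-IDEAS-stub_pasten163-1.md §2.
-/

set_option linter.dupNamespace false

noncomputable section

namespace Summit.ABC.ABC.Cruxes.DefiniteRTControlPrime.Sketch.Ideas1g8

open Literature.NumberTheory.EllipticCurves Literature.NumberTheory.GaloisRepresentations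
open WeierstrassCurve

/-- C1 — the 13-leaf of the torsion road, in the Diophantine form the tree reduced Mazur–Tate 1973 to
(`MazurTate1973_no_torsion_thirteen_iff_raw₁₃`): the genus-2 curve `X₁(13) : F₁₃(r,s) = 0` has only
degenerate rational points. OPEN in the tree (needs `|J₁(13)(ℚ)| < ∞`); L–XL. -/
def MazurTateRaw13 : Prop :=
  ∀ r s : ℚ, (kubertTate (r * s * (r - 1)) (s * (r - 1))).Δ ≠ 0 → kubertTateRaw₁₃ r s ≠ 0

/-- C1 ⇒ the named fact, by the tree's equivalence. -/
theorem mazurTate_of_raw13 (h : MazurTateRaw13) (V : WeierstrassCurve ℚ) :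
    MazurTate1973_no_torsion_thirteen V :=
  MazurTate1973_no_torsion_thirteen_iff_raw₁₃.mpr h V

/-- C2 — Diamond–Kramer dichotomy + Swan parity at `p = 13` (port of the LANDED `p = 5` stubs
`stub_freySemistableDichotomy`, `stub_freySwanOdd` (`Sw(E[13]) = Sw(E[3])`), `stub_swanEvenOfStableLine`,
glue `stub_freyFiveIrreducibleGlue` with `(⋆₁₃)` := `noTwoTorsionPrime_thirteen_of h13` in place of
Kubert's `X₁(2,10)`), general `(a,b)` via `hasIrreducibleModPGaloisRep_freyCurve_translate_iff/_swap_iff`. M–L. -/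
theorem freyThirteenIrreducible_of_mazurTate
    (h13 : ∀ V : WeierstrassCurve ℚ, MazurTate1973_no_torsion_thirteen V)
    {a b : ℤ} (hab : IsCoprime a b) (h0 : a * b * (a + b) ≠ 0) :
    haveI := isElliptic_freyCurve h0
    (freyCurve a b).HasIrreducibleModPGaloisRep 13 := by
  sorry

/-- C3 — generic bridge (k2-g3 `not_dvd_degree_of_hasIrreducibleModPGaloisRep`, PROVED there at any `p`):
irreducible `E[13]` ⇒ `13` divides the degree of no cyclic `ℚ`-isogeny out of `E`. S. -/
theorem thirteen_not_dvd_degree_of_irreducible {W W' : WeierstrassCurve ℚ} [W.IsElliptic]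
    [W'.IsElliptic] (hirr : W.HasIrreducibleModPGaloisRep 13) (ψ : Isogeny W W')
    (hψ : ψ.IsCyclic) : ¬ 13 ∣ ψ.degree := by
  sorry

/-- Assembly of Plan C: the same conclusion as k2-g3's `thirteen_not_dvd_degree_freyCurve h13KF`,
with Mazur–Tate in place of Klein–Fricke 13. -/
theorem thirteen_not_dvd_degree_freyCurve_of_mazurTate
    (h13 : ∀ V : WeierstrassCurve ℚ, MazurTate1973_no_torsion_thirteen V) {a b : ℤ}
    (hab : IsCoprime a b) (h0 : a * b * (a + b) ≠ 0) {W' : WeierstrassCurve ℚ} [W'.IsElliptic]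
    (ψ : Isogeny (freyCurve a b) W') (hψ : ψ.IsCyclic) :
    ¬ 13 ∣ ψ.degree := by
  haveI := isElliptic_freyCurve h0
  exact thirteen_not_dvd_degree_of_irreducible
    (freyThirteenIrreducible_of_mazurTate h13 hab h0) ψ hψ

end Summit.ABC.ABC.Cruxes.DefiniteRTControlPrime.Sketch.Ideas1g8

end
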